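import Literature.MathematicalPhysics.QuantumFieldTheory.Balaban1983to89.Node00.N24GlueThreshold
import Literature.MathematicalPhysics.QuantumFieldTheory.Balaban1983to89.B14NodeKnitRecord5C
import Literature.MathematicalPhysics.QuantumFieldTheory.Balaban1983to89.B13NodeKnitRecord5C
import Literature.MathematicalPhysics.QuantumFieldTheory.Balaban1983to89.B10LeafUnpinnedRecord5C

/-!
# NODE N24 · binder B2 at THE RECORD PREDICATE OF RECORD `IsRecordOfRecord₅C` WITH THE CHILDREN N08, N10, N11, N13 ENTERED BY NAME AT THEIR
# CURRENT STATEMENTS OF RECORD (`B10LeafUnpinnedRecord5C.b10_main_of_isRecordOfRecord₅C_of_slots`, seat dag-n08-a;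
# `B13NodeKnitRecord5C.b13_main_of_isRecordOfRecord₅C`, seat dag-p2 = n10-a; `B14NodeKnitRecord5C.b14_main_of_isRecordOfRecord₅C`, seat dag-n11-a;
# `B16NodeKnitRecord5C.b16_main_reExp_of_isRecordOfRecord₅C`, seat dag-n13-a — through `Node00.N24_at_record₅C_knit₁₃`, module 7)

TRACK A (YM-PLAN §2d, node N24 of 28), seat `pub-ymgap-dag-n24-a` (-a KNIT-BY-NAME: «keep the glue elaborating against the children's CURRENT statements
of record … report which child blocks»).  NINTH N24 module, a NEW importing one (append-only growth); the `₅C` twin of module 6 (`Node00.N24KnitStage5`,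
p412507, which knits N11 + N13 at the N-binding `IsRecordOfRecord₅`).  Since module 6 three more children landed knits AT THE PREDICATE OF RECORD
`IsRecordOfRecord₅C` (C-binding of the [Balaban1985UV3] leaf, pub-ymgap chair R434 (Q2) = (C)) in the common «slots» shape «for every admissible
`θ : Stage5Params F N` with `D = datumOfRecord₅ F N θ` whose C-binding `upOfRecord₅C F N θ` binds `w`, at every run …»:
* N08 = [Balaban1985UV3] Thm 1 (compact reading) ∧ Thm 2 — `B10LeafUnpinnedRecord5C.b10_main_of_isRecordOfRecord₅C_of_slots h slots₀₈` (p412273, dag-n08-a g2):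
  slot (B10₅) «the residual carrier `θ.res.X P` IS a tower-run carrier `Xc.withTowerRuns10 T` whose runs carry `B10Assembly.LeafSystem`s»;
* N10 = [Balaban1988RG2Cluster] Lemmas 1–3 — `B13NodeKnitRecord5C.b13_main_of_isRecordOfRecord₅C h slots₁₀` (p412849, dag-p2 g4): slot (B13₅) «the in-edge
  leaves at the residual carriers imply the B13 triple of the residual B13 group `((θ.res.X P).S13, (θ.res.X P).c13)`»;
* N11 = [Balaban1988Convergent] Thm 1 + Theorem p. 245 + assumed 𝐑 p. 244 — `B14NodeKnitRecord5C.b14_main_of_isRecordOfRecord₅C h slots₁₁` (p412417,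
  dag-n11-a g3): pins (P1₅) (P3₅) and slots (S0) (S1), verbatim as at `₅` but for the C-binding;
* N13 = [Balaban1989LargeFieldII] Thm 1 ∧ [III] Cor. 3 — `B16NodeKnitRecord5C.b16_main_reExp_of_isRecordOfRecord₅C eM eP h hR hcor`, already composed into
  `Node00.N24_at_record₅C_knit₁₃` (module 7, p412857).
They are composed here INTO ONE glue theorem in the kernel — an integration check by name that the four children's displayed slot signatures and the
glue's binders agree letter for letter at `₅C`.  THEOREMS ONLY, def-free, sorry-free, standard axioms.

* `N24_at_record₅C_knit₀₈₁₀₁₁₁₃` — (B2) `B16.EndStatementBPrinted D.C` at a `₅C` record from: N03, N05, N06, N07, N09, N12 as by-name binders at the record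
  world; N08's, N10's, N11's slots; N13's exponent families + slots; the β-box bounds on `D.βfun`.  `…_of_prop26`: N03 at its statement of record too.
* `N24_binders₅C_after_knit` — the REMAINING binder list displayed as one `Prop`-valued implication, for the hourly «which child blocks».

WHICH CHILD BLOCKS after this knit (2026-08-26T00:4xZ): THEOREMS at `₅C` — N01 N02 N04 N23, `hC` `hγ` guarded (0.20) (`Record5C`); BY NAME MODULO
DISPLAYED SLOTS — N03 (Prop. 2.6 census, `b6_main_of_isRecordOfRecord₅C_of_prop26`), N08 ((B10₅): `Residual₅.X`'s B10 group unpinned — UNDETERMINED over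
`₅C` as it stands, `B10LeafUnpinnedRecord5C.b10_main_undetermined_over_record₅C`; closes at a B10-pinning stage with the d = 3 lane's constructed family,
`BalabanUVNodesN08Constructed`), N10 ((B13₅) over the free residual B13 group; torus pin proposed, `B13NodeKnitRecord5C.b13_main_forall_isRecordOfRecord₅C_twoTorus`),
N11 ((P1₅) (P3₅) (S0) (S1) over `Residual₅.V ∕ R ∕ S218`), N13 ((R₅) + the five Cor.-3 leaves at `(w.γ, e₋ D, e₊ D)`; residue = Stage ₉'s represented
tower, chair R437); PURE BINDERS — N05 [B8] (`B8LeafKnit.b8_main_of_up_knit…` at the N-binding only), N06 [B9] (UNDETERMINED over `₅`∕`₅C`: free residual `Y`,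
`B9LeafUnpinnedRecord5`), N07 [B11] (`B11LeafKnitFull`), N09 [B12] (`B12NodeKnit` v3), N12 [B15] (`B15LeafKnit*`); the β-box bounds (`b > 0` UNPRINTED
T09.F — NODE O ∕ (D1)(D4) roads; `β⁺` [Balaban1987RG1] p. 264) — at Stage ₈ `D.βfun = betaOfRecord₈ θ` (node00-def `Record8`, staged) and the two bounds
read `BalabanUVNodesN28AtBetaOfRecord.betaLowerH_betaOfMerged_iff ∕ betaUpperH_betaOfMerged_iff`.  ETA(N24) = max(N13, β-side, the pinning stages).
HONEST FRAMING: kernel bookkeeping BY NAME; every slot is a HYPOTHESIS displayed by the child's seat, nothing of Bałaban's asserted; N24 COMPOSITE — no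
discharge, no count; over `₅C` AS IT STANDS the universal forms of N06 ∕ N08 are refutable given their sisters (free residual carriers), so the per-record
binder form is the non-vacuous currency; finite T⁴ at fixed ε; NOT ℝ⁴ ∕ OS ∕ mass gap ∕ Clay.
-/

noncomputable section

namespace Literature.MathematicalPhysics.QuantumFieldTheory.Balaban1983to89.Node00

open DagBinding T4Continuum T4DatumAssembly FlowStepRuns AveragingRT

variable {F : T4Family} {N : ℕ} [NeZero N] {D : FiniteEpsData F (SU N)} {w : WorldP}

/-- **N24 · (B2) at a `₅C` record with N08, N10, N11 and N13 KNIT BY NAME.**  Inputs: the record `h`; `w.γ ≤ γ₀`; N03, N05, N06, N07, N09, N12 at every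
run of `w` (binders); N08's slot VERBATIM as `B10LeafUnpinnedRecord5C.b10_main_of_isRecordOfRecord₅C_of_slots` displays it (the residual carrier at the run is a
tower-run carrier with [Balaban1985UV3] leaf systems); N10's slot VERBATIM as `B13NodeKnitRecord5C.b13_main_of_isRecordOfRecord₅C` displays it (in-edge leaves at
the residual carriers ⇒ the [Balaban1988RG2Cluster] triple of the residual B13 group); N11's slots VERBATIM as `B14NodeKnitRecord5C.b14_main_of_isRecordOfRecord₅C`
displays them ((P1₅) (P3₅) (S0) (S1)); N13's datum-indexed exponent families `e₋ e₊` with (R₅) and the five Cor.-3 leaves at `(w.γ, e₋ D, e₊ D)` VERBATIM as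
`B16NodeKnitRecord5C.b16_main_reExp_of_isRecordOfRecord₅C` displays them; the box bounds `w.b ≤ D.βfun ≤ w.βup` on `]0, γ₀]^{k+1}`.  Output:
`B16.EndStatementBPrinted D.C`, by `N24_at_record₅C_knit₁₃` with `h08`, `h10`, `h11` the three children's knits. [cite: Balaban1989LargeFieldII, Thm 1 p.355 + pp.387, 391; Balaban1985UV3, Thm 1 p.257 (compact reading) + Thm 2 p.272; Balaban1988RG2Cluster, Lemmas 1–3 pp.9, 11, 20; Balaban1988Convergent, Thm 1 p.262, Theorem p.245, p.244, Cor. 3 (2.50) p.264; Balaban1987RG1, (1.22) p.264 (bookkeeping over the pinned form)] -/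
theorem N24_at_record₅C_knit₀₈₁₀₁₁₁₃ (h : IsRecordOfRecord₅C F N D w) {γ₀ : ℝ} (hγ₀ : w.γ ≤ γ₀)
    (h03 : ∀ P : B12.RunParams, Dag.B6_main (leavesP w P)) (h05 : ∀ P : B12.RunParams, Dag.B8_main (leavesP w P))
    (h06 : ∀ P : B12.RunParams, Dag.B9_main (leavesP w P)) (h07 : ∀ P : B12.RunParams, Dag.B11_main (leavesP w P))
    (h09 : ∀ P : B12.RunParams, Dag.B12_main (leavesP w P)) (h12 : ∀ P : B12.RunParams, Dag.B15_main (leavesP w P))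
    (slots₀₈ : ∀ θ : Stage5Params F N, θ.Admissible → D = datumOfRecord₅ F N θ →
      (∀ P, w.up P = upOfRecord₅C F N θ P) → ∀ P : B12.RunParams,
        ∃ (Xc : PrintedCarriersR) (I : Type) (C : B10Assembly.Consts) (T : I → B10.TowerRun),
          Nonempty (∀ i, B10Assembly.LeafSystem C (T i)) ∧ θ.res.X P = Xc.withTowerRuns10 T)
    (slots₁₀ : ∀ θ : Stage5Params F N, θ.Admissible → D = datumOfRecord₅ F N θ →
      (∀ P, w.up P = upOfRecord₅C F N θ P) → ∀ P : B12.RunParams,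
        B9LeafX (θ.res.Y P) →
          (B10.Thm1PrintedCompact (θ.res.X P).runs10 ∧ B10.Thm2Printed (θ.res.X P).runs10) →
            B11Leaf (θ.res.Z P) → B12Sec2to5.Lemma4Printed (θ.res.X P).F12 (θ.res.X P).c12 →
              B13.Lemma1Printed (θ.res.X P).S13 (θ.res.X P).c13 ∧ B13.Lemma2Printed (θ.res.X P).S13 (θ.res.X P).c13 ∧
                B13.Lemma3Printed (θ.res.X P).S13 (θ.res.X P).c13)
    (slots₁₁ : ∀ θ : Stage5Params F N, θ.Admissible → D = datumOfRecord₅ F N θ →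
      (∀ P, w.up P = upOfRecord₅C F N θ P) → ∀ P : B12.RunParams,
        ∃ S Scorr : (k : ℕ) → Density (F.P P.K) k (SU N) → Prop,
          (ROpLeaf (θ.res.V P) → B14.RAssumedP244 (θ.res.R P) Scorr S P.K) ∧
          (∀ k, k ≤ P.K → S k (densOfRecord₅ F N θ P k) → θ.res.S218 P k (densOfRecord₅ F N θ P k)) ∧
          ((leavesP w P).smallCouplings → S 0 (rhoZeroOfRecord F N P.K P.g0 (θ.res.E P))) ∧
          ((leavesP w P).b7 → (leavesP w P).b8 → (leavesP w P).b9 → (leavesP w P).b10 → (leavesP w P).b11 →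
            (leavesP w P).smallCouplings → (leavesP w P).smallFieldInductive → (leavesP w P).flowControl →
              ∀ k, k < P.K → S k (densOfRecord₅ F N θ P k) →
                Scorr (k + 1) (TrhoOfRecord F N P.K k (densOfRecord₅ F N θ P k))))
    (eM eP : FiniteEpsData F (SU N) → ℝ → ℝ)
    (hR : ∀ θ : Stage5Params F N, θ.Admissible → D = datumOfRecord₅ F N θ → ∀ P : B12.RunParams, ROpLeaf (θ.res.V P))
    (hcor : ∀ θ : Stage5Params F N, θ.Admissible → D = datumOfRecord₅ F N θ →
      ∃ R : B14Cor3.ReprFamily (datumOfRecord₅ F N θ).C,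
        B14Cor3.LeafH (datumOfRecord₅ F N θ).C R w.γ ∧ B14Cor3.LeafU1 (datumOfRecord₅ F N θ).C R w.γ ∧
        B14Cor3.LeafU2 (datumOfRecord₅ F N θ).C R w.γ (eP D) ∧ B14Cor3.LeafL1 (datumOfRecord₅ F N θ).C R w.γ ∧
        B14Cor3.LeafL2 (datumOfRecord₅ F N θ).C R w.γ (eM D))
    (hlo : FlowStep.BetaLowerH w.b γ₀ D.βfun) (hhi : FlowStep.BetaUpperH w.βup γ₀ D.βfun) :
    B16.EndStatementBPrinted D.C :=
  N24_at_record₅C_knit₁₃ h hγ₀ h03 h05 h06 h07 (B10LeafUnpinnedRecord5C.b10_main_of_isRecordOfRecord₅C_of_slots h slots₀₈) h09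
    (B13NodeKnitRecord5C.b13_main_of_isRecordOfRecord₅C h slots₁₀) (B14NodeKnitRecord5C.b14_main_of_isRecordOfRecord₅C h slots₁₁) h12
    eM eP hR hcor hlo hhi

/-- **The same knit with N03 entered at ITS statement of record** (modulo the [Balaban1984PropagatorsII] Prop. 2.6 census,
`Record5C.b6_main_of_isRecordOfRecord₅C_of_prop26`): FIVE pure binders N05, N06, N07, N09, N12 remain beside the displayed slots of N03 ∕ N08 ∕ N10 ∕ N11 ∕
N13 and the β-box bounds. [cite: Balaban1989LargeFieldII, Thm 1 p.355 + p.391; Balaban1984PropagatorsII, Prop. 2.6 (2.136)–(2.140) p.247; Balaban1985UV3, Thm 1 p.257 + Thm 2 p.272; Balaban1988RG2Cluster, Lemmas 1–3 pp.9, 11, 20; Balaban1988Convergent, Thm 1 p.262, Cor. 3 (2.50) p.264 (bookkeeping)] -/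
theorem N24_at_record₅C_knit₀₈₁₀₁₁₁₃_of_prop26 (h : IsRecordOfRecord₅C F N D w) {γ₀ : ℝ} (hγ₀ : w.γ ≤ γ₀)
    (h26 : ∀ θ : Stage3Params, θ.toStage1Params.Admissible →
      B6.Prop26Printed (fun i : B6KLevelCensusIndexV1.KIdx θ.d₆ θ.ℓ₆ θ.hd' θ.hL' θ.b₀ θ.b₁ => B6KLevelCensusIndexV1.kGeoG i)
        (fun i => B6Prop26Census2136KLevelV1.kG i))
    (h05 : ∀ P : B12.RunParams, Dag.B8_main (leavesP w P))
    (h06 : ∀ P : B12.RunParams, Dag.B9_main (leavesP w P)) (h07 : ∀ P : B12.RunParams, Dag.B11_main (leavesP w P))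
    (h09 : ∀ P : B12.RunParams, Dag.B12_main (leavesP w P)) (h12 : ∀ P : B12.RunParams, Dag.B15_main (leavesP w P))
    (slots₀₈ : ∀ θ : Stage5Params F N, θ.Admissible → D = datumOfRecord₅ F N θ →
      (∀ P, w.up P = upOfRecord₅C F N θ P) → ∀ P : B12.RunParams,
        ∃ (Xc : PrintedCarriersR) (I : Type) (C : B10Assembly.Consts) (T : I → B10.TowerRun),
          Nonempty (∀ i, B10Assembly.LeafSystem C (T i)) ∧ θ.res.X P = Xc.withTowerRuns10 T)
    (slots₁₀ : ∀ θ : Stage5Params F N, θ.Admissible → D = datumOfRecord₅ F N θ →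
      (∀ P, w.up P = upOfRecord₅C F N θ P) → ∀ P : B12.RunParams,
        B9LeafX (θ.res.Y P) →
          (B10.Thm1PrintedCompact (θ.res.X P).runs10 ∧ B10.Thm2Printed (θ.res.X P).runs10) →
            B11Leaf (θ.res.Z P) → B12Sec2to5.Lemma4Printed (θ.res.X P).F12 (θ.res.X P).c12 →
              B13.Lemma1Printed (θ.res.X P).S13 (θ.res.X P).c13 ∧ B13.Lemma2Printed (θ.res.X P).S13 (θ.res.X P).c13 ∧
                B13.Lemma3Printed (θ.res.X P).S13 (θ.res.X P).c13)
    (slots₁₁ : ∀ θ : Stage5Params F N, θ.Admissible → D = datumOfRecord₅ F N θ →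
      (∀ P, w.up P = upOfRecord₅C F N θ P) → ∀ P : B12.RunParams,
        ∃ S Scorr : (k : ℕ) → Density (F.P P.K) k (SU N) → Prop,
          (ROpLeaf (θ.res.V P) → B14.RAssumedP244 (θ.res.R P) Scorr S P.K) ∧
          (∀ k, k ≤ P.K → S k (densOfRecord₅ F N θ P k) → θ.res.S218 P k (densOfRecord₅ F N θ P k)) ∧
          ((leavesP w P).smallCouplings → S 0 (rhoZeroOfRecord F N P.K P.g0 (θ.res.E P))) ∧
          ((leavesP w P).b7 → (leavesP w P).b8 → (leavesP w P).b9 → (leavesP w P).b10 → (leavesP w P).b11 →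
            (leavesP w P).smallCouplings → (leavesP w P).smallFieldInductive → (leavesP w P).flowControl →
              ∀ k, k < P.K → S k (densOfRecord₅ F N θ P k) →
                Scorr (k + 1) (TrhoOfRecord F N P.K k (densOfRecord₅ F N θ P k))))
    (eM eP : FiniteEpsData F (SU N) → ℝ → ℝ)
    (hR : ∀ θ : Stage5Params F N, θ.Admissible → D = datumOfRecord₅ F N θ → ∀ P : B12.RunParams, ROpLeaf (θ.res.V P))
    (hcor : ∀ θ : Stage5Params F N, θ.Admissible → D = datumOfRecord₅ F N θ →
      ∃ R : B14Cor3.ReprFamily (datumOfRecord₅ F N θ).C,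
        B14Cor3.LeafH (datumOfRecord₅ F N θ).C R w.γ ∧ B14Cor3.LeafU1 (datumOfRecord₅ F N θ).C R w.γ ∧
        B14Cor3.LeafU2 (datumOfRecord₅ F N θ).C R w.γ (eP D) ∧ B14Cor3.LeafL1 (datumOfRecord₅ F N θ).C R w.γ ∧
        B14Cor3.LeafL2 (datumOfRecord₅ F N θ).C R w.γ (eM D))
    (hlo : FlowStep.BetaLowerH w.b γ₀ D.βfun) (hhi : FlowStep.BetaUpperH w.βup γ₀ D.βfun) :
    B16.EndStatementBPrinted D.C :=
  N24_at_record₅C_knit₀₈₁₀₁₁₁₃ h hγ₀ (b6_main_of_isRecordOfRecord₅C_of_prop26 h26 h) h05 h06 h07 h09 h12 slots₀₈ slots₁₀ slots₁₁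
    eM eP hR hcor hlo hhi

/-- **WHICH CHILD BLOCKS at `₅C`, in kernel form**: after the knit the (B2) binder at a `₅C` record is implied by the FIVE pure child binders N05 [B8],
N06 [B9], N07 [B11], N09 [B12], N12 [B15] at the record world together with N03's census, N08's, N10's, N11's slots, N13's exponent families + slots and
the β-box bounds — one implication, every antecedent displayed (nothing asserted). [cite: Balaban1989LargeFieldII, Thm 1 p.355 + p.391 (bookkeeping: the residual binder list of N24 at the Stage-5 record predicate of record)] -/
theorem N24_binders₅C_after_knit (h : IsRecordOfRecord₅C F N D w) {γ₀ : ℝ} (hγ₀ : w.γ ≤ γ₀)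
    (h26 : ∀ θ : Stage3Params, θ.toStage1Params.Admissible →
      B6.Prop26Printed (fun i : B6KLevelCensusIndexV1.KIdx θ.d₆ θ.ℓ₆ θ.hd' θ.hL' θ.b₀ θ.b₁ => B6KLevelCensusIndexV1.kGeoG i)
        (fun i => B6Prop26Census2136KLevelV1.kG i))
    (slots₀₈ : ∀ θ : Stage5Params F N, θ.Admissible → D = datumOfRecord₅ F N θ →
      (∀ P, w.up P = upOfRecord₅C F N θ P) → ∀ P : B12.RunParams,
        ∃ (Xc : PrintedCarriersR) (I : Type) (C : B10Assembly.Consts) (T : I → B10.TowerRun),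
          Nonempty (∀ i, B10Assembly.LeafSystem C (T i)) ∧ θ.res.X P = Xc.withTowerRuns10 T)
    (slots₁₀ : ∀ θ : Stage5Params F N, θ.Admissible → D = datumOfRecord₅ F N θ →
      (∀ P, w.up P = upOfRecord₅C F N θ P) → ∀ P : B12.RunParams,
        B9LeafX (θ.res.Y P) →
          (B10.Thm1PrintedCompact (θ.res.X P).runs10 ∧ B10.Thm2Printed (θ.res.X P).runs10) →
            B11Leaf (θ.res.Z P) → B12Sec2to5.Lemma4Printed (θ.res.X P).F12 (θ.res.X P).c12 →
              B13.Lemma1Printed (θ.res.X P).S13 (θ.res.X P).c13 ∧ B13.Lemma2Printed (θ.res.X P).S13 (θ.res.X P).c13 ∧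
                B13.Lemma3Printed (θ.res.X P).S13 (θ.res.X P).c13)
    (slots₁₁ : ∀ θ : Stage5Params F N, θ.Admissible → D = datumOfRecord₅ F N θ →
      (∀ P, w.up P = upOfRecord₅C F N θ P) → ∀ P : B12.RunParams,
        ∃ S Scorr : (k : ℕ) → Density (F.P P.K) k (SU N) → Prop,
          (ROpLeaf (θ.res.V P) → B14.RAssumedP244 (θ.res.R P) Scorr S P.K) ∧
          (∀ k, k ≤ P.K → S k (densOfRecord₅ F N θ P k) → θ.res.S218 P k (densOfRecord₅ F N θ P k)) ∧
          ((leavesP w P).smallCouplings → S 0 (rhoZeroOfRecord F N P.K P.g0 (θ.res.E P))) ∧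
          ((leavesP w P).b7 → (leavesP w P).b8 → (leavesP w P).b9 → (leavesP w P).b10 → (leavesP w P).b11 →
            (leavesP w P).smallCouplings → (leavesP w P).smallFieldInductive → (leavesP w P).flowControl →
              ∀ k, k < P.K → S k (densOfRecord₅ F N θ P k) →
                Scorr (k + 1) (TrhoOfRecord F N P.K k (densOfRecord₅ F N θ P k))))
    (eM eP : FiniteEpsData F (SU N) → ℝ → ℝ)
    (hR : ∀ θ : Stage5Params F N, θ.Admissible → D = datumOfRecord₅ F N θ → ∀ P : B12.RunParams, ROpLeaf (θ.res.V P))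
    (hcor : ∀ θ : Stage5Params F N, θ.Admissible → D = datumOfRecord₅ F N θ →
      ∃ R : B14Cor3.ReprFamily (datumOfRecord₅ F N θ).C,
        B14Cor3.LeafH (datumOfRecord₅ F N θ).C R w.γ ∧ B14Cor3.LeafU1 (datumOfRecord₅ F N θ).C R w.γ ∧
        B14Cor3.LeafU2 (datumOfRecord₅ F N θ).C R w.γ (eP D) ∧ B14Cor3.LeafL1 (datumOfRecord₅ F N θ).C R w.γ ∧
        B14Cor3.LeafL2 (datumOfRecord₅ F N θ).C R w.γ (eM D))
    (hlo : FlowStep.BetaLowerH w.b γ₀ D.βfun) (hhi : FlowStep.BetaUpperH w.βup γ₀ D.βfun) :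
    ((∀ P : B12.RunParams, Dag.B8_main (leavesP w P)) → (∀ P : B12.RunParams, Dag.B9_main (leavesP w P)) →
      (∀ P : B12.RunParams, Dag.B11_main (leavesP w P)) → (∀ P : B12.RunParams, Dag.B12_main (leavesP w P)) →
      (∀ P : B12.RunParams, Dag.B15_main (leavesP w P)) → B16.EndStatementBPrinted D.C) :=
  fun h05 h06 h07 h09 h12 =>
    N24_at_record₅C_knit₀₈₁₀₁₁₁₃_of_prop26 h hγ₀ h26 h05 h06 h07 h09 h12 slots₀₈ slots₁₀ slots₁₁ eM eP hR hcor hlo hhi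

end Literature.MathematicalPhysics.QuantumFieldTheory.Balaban1983to89.Node00

end
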